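import Mathlib
import Summits.KontsevichZagierPeriods.Zeta5Search.BigPrimeDual
import HarnessLib

/-!
# ζ(5) search — BIG-PRIME DIVISIBILITY of the ζ(3)- and ζ(5)-coefficients of `F̃₇(b)` (THEOREMS (W∞), (U∞))

Cell `pub-zeta5` (HONEST FRAMING: systematic search; no irrationality claim unless certified), typer seat
generation 7; statement discovered in exact data and proved on paper by the gen-2 seat (REPORT-gen2-g5 §5f,
`HOME/pub-zeta5-gen-2/`), formalised here.  OUR theorem (Summit side), not a cited fact; it is a divisibility
property of a coefficient and says nothing about irrationality.

**THEOREM (W∞)** (`one_le_padicValRat_coeffW`).  Let `b = (b₀; b₁,…,b₇) ∈ ℤ⁸` lie in the Brown–Zudilin polytope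
(`0 ≤ 2b_j ≤ b₀`, `Σ_j b_j ≤ 3b₀`) and let `p` be a prime with `max(5, b₀+1) ≤ p ≤ d(b) + 1 = 3b₀ + 1 − Σ_j b_j` (the
Bailey excess of the underlying very-well-poised series).  Then `p` divides the canonical ζ(3)-coefficient `W(b)`
of `F̃₇(b) = Uζ(5) + Wζ(3) − V` (`WedgeDictionary.coeffW`, `vwp_decomposition`): `v_p(W(b)) ≥ 1` (for `W(b) ≠ 0`).
**THEOREM (U∞)** (`one_le_padicValRat_coeffU`): the same for the ζ(5)-coefficient `U(b)` when `2p ≤ d(b) + 1`.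
(The paper proof excluded `p = 5`; it is covered here because `M_b` vanishes at every pole, see below.)

PROOF (Wilson duality; `y = t+1` coordinates, `n = b₀`, blocks `B_j = [b_j, n − b_j]`, `R_b = numPoly(y)/∏_{s≤n}(y+s)^6
= (2y+n)·∏_{s≤n}(y+s)·∏_j 1/∏_{s∈B_j}(y+s)`).
1. (`BigPrimePoles`) `e₀(q)^6 · c_{o,q} = z_{q,5−o} ∈ ℤ` with `p ∤ e₀(q)`; so `U·W = Z := Σ_q z_{q,3} ∏_{s≠q} e₀(s)^6`
   with `U = ∏_q e₀(q)^6`, `p ∤ U` (`Uall_mul_sum_eq`).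
2. (`BigPrimeDual.pall_pow_mul_MF`) In `𝔽_p[X]`, `∏_{u∈𝔽_p}(X+u) = X^p − X` gives `(∏_{s≤n}(X+s))^6 · M_b = numR · (X^p−X)^7` for the
   DUAL POLYNOMIAL `M_b = (2X+n) ∏_{s≤n}(X+s) ∏_j ∏_{u ∈ 𝔽_p∖B_j}(X+u)` (`MF`).
3. (`BigPrimeDual`, `zZ_cast`) Shifting to a pole (`taylor (−q)`; `X^p − X` is translation invariant) and cancelling `X^7`:
   `E_q · M̃ = numR(X−q) · (X^{p−1}−1)^7` with `M_b(X−q) = X·M̃`, hence `numR(X−q)·J_q ≡ −e₀^6 M̃ (mod X^4)` and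
   `z_{q,i} ≡ −e₀(q)^6 · [X^{i+1}] M_b(X−q)` for `i < 4` (this is where `p ≥ 5` enters).
4. (`sum_univ_taylor_MF_coeff`) Off the poles `M_b` vanishes to order 7, so `Z ≡ −U · Σ_{x∈𝔽_p} [X^4] M_b(X+x)`
   (`Zsum_cast`); by the power-sum lemma (`ExcessWindow.sum_eval_iterate_derivative_eq_zero`, gen-2) this is `0` as
   soon as `deg M_b < 5p − 1`, and `deg M_b ≤ 7p − 6n − 5 + 2Σb_j` (`natDegree_MF_le`) makes that `p ≤ d+1`; for `U`
   the coefficient is `[X^2]` and the condition `deg M_b < 3p − 1`, i.e. `2p ≤ d+1`.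
5. (`one_le_padicValRat_of_eq`) `U·W = Z`, `p ∣ Z`, `p ∤ U` ⟹ `v_p(W) ≥ 1`.
NOT here: primes `p ≤ b₀` (the blocks wrap around modulo `p`; that is where the pair-floor terms of the cell's
OBSERVED laws (CV)/(WV) of `Zeta5Search/CasoratianValuation.lean` enter), and the minors.
-/

noncomputable section

open Finset Polynomial

namespace Summit.KontsevichZagierPeriods.Zeta5Search.BigPrime

open Summit.KontsevichZagierPeriods.Zeta5Search.DualSeries (InBox)
open Summit.KontsevichZagierPeriods.Zeta5Search.WedgeDictionary (IsPFData)

/-! ### Off the poles, the degree count -/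

section ModP

variable {p : ℕ} [hp : Fact p.Prime]

/-- Off the poles `M_b` vanishes to order `7`: for `x ∉ {−s : s ≤ n}`, `X^7 ∣ M_b(X + x)`. -/
theorem X_pow_seven_dvd_taylor_MF {n : ℕ} (β : ℕ → ℕ) (x : ZMod p)
    (hx : x ∉ (range (n + 1)).image fun q : ℕ => -((q : ℕ) : ZMod p)) :
    (X : (ZMod p)[X]) ^ 7 ∣ taylor x (MF p n β) := by
  have hK : ∀ j ∈ range 7, (X : (ZMod p)[X]) ∣ taylor x (KF p n (β j)) := by
    intro j _
    have hmem : -x ∈ univ \ blockF p n (β j) := by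
      rw [mem_sdiff]
      refine ⟨mem_univ _, fun h => hx ?_⟩
      rw [blockF, mem_image] at h
      obtain ⟨s, hs, hsx⟩ := h
      exact mem_image.2 ⟨s, block_subset n (β j) hs, by rw [hsx, neg_neg]⟩
    rw [KF, taylor_prod']
    have hfac : taylor x (X + C (-x)) = X := by rw [taylor_X_add_C, neg_add_cancel, C_0, add_zero]
    exact (dvd_of_eq hfac.symm).trans (Finset.dvd_prod_of_mem (fun u : ZMod p => taylor x (X + C u)) hmem)
  rw [MF, taylor_mul, taylor_prod']
  have h7 : (X : (ZMod p)[X]) ^ 7 = ∏ _j ∈ range 7, (X : (ZMod p)[X]) := by simp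
  rw [h7]
  exact (Finset.prod_dvd_prod_of_dvd _ _ hK).mul_left _

/-- The pole sum IS the full sum over `𝔽_p` (coefficients of order `< 7`). -/
theorem sum_univ_taylor_MF_coeff {n : ℕ} (hn : n < p) (β : ℕ → ℕ) {k : ℕ} (hk : k < 7) :
    ∑ x : ZMod p, (taylor x (MF p n β)).coeff k =
      ∑ q ∈ range (n + 1), (taylor (-((q : ℕ) : ZMod p)) (MF p n β)).coeff k := by
  have hinj : Set.InjOn (fun q : ℕ => -((q : ℕ) : ZMod p)) (range (n + 1) : Finset ℕ) := by
    intro a ha b hb hab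
    exact cast_injOn_range hn ha hb (neg_inj.1 hab)
  have hzero : ∀ x ∈ (univ : Finset (ZMod p)),
      x ∉ (range (n + 1)).image (fun q : ℕ => -((q : ℕ) : ZMod p)) → (taylor x (MF p n β)).coeff k = 0 :=
    fun x _ hx => (X_pow_dvd_iff.1 (X_pow_seven_dvd_taylor_MF β x hx)) k hk
  rw [← sum_subset (subset_univ _) hzero, sum_image hinj]

/-- Degree count: `deg M_b + 6n + 5 ≤ 7p + 2 Σ_j β_j` (for `n < p`, `2β_j ≤ n`). -/
theorem natDegree_MF_le {n : ℕ} (hn : n < p) (β : ℕ → ℕ) (hβ : ∀ j ∈ range 7, 2 * β j ≤ n) :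
    (MF p n β).natDegree + 6 * n + 5 ≤ 7 * p + 2 * ∑ j ∈ range 7, β j := by
  have hlin : (C (2 : ZMod p) * X + C (n : ZMod p)).natDegree ≤ 1 := by
    refine (natDegree_add_le _ _).trans (max_le ?_ (by simp))
    exact (natDegree_C_mul_le _ _).trans natDegree_X_le
  have hpall : (pall p n).natDegree ≤ n + 1 := by
    rw [pall]
    refine (natDegree_prod_le _ _).trans ?_
    simp only [natDegree_X_add_C, sum_const, card_range, smul_eq_mul, mul_one, le_refl]
  have hK : ∀ j ∈ range 7, (KF p n (β j)).natDegree + (n + 1) ≤ p + 2 * β j := by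
    intro j hj
    have hb := hβ j hj
    have hcard : #(blockF p n (β j)) = (n - β j) + 1 - β j := by
      rw [blockF, card_image_of_injOn ((cast_injOn_range hn).mono (by exact_mod_cast block_subset n (β j))),
        block, Nat.card_Icc]
    have hdeg : (KF p n (β j)).natDegree ≤ p - #(blockF p n (β j)) := by
      rw [KF]
      refine (natDegree_prod_le _ _).trans ?_
      simp only [natDegree_X_add_C, sum_const, card_univ_sdiff, ZMod.card, smul_eq_mul, mul_one, le_refl]
    rw [hcard] at hdeg
    omega
  have hKsum := sum_le_sum hK
  simp only [sum_add_distrib, sum_const, card_range, smul_eq_mul] at hKsum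
  have hprod : (∏ j ∈ range 7, KF p n (β j)).natDegree ≤ ∑ j ∈ range 7, (KF p n (β j)).natDegree :=
    natDegree_prod_le _ _
  have hMF : (MF p n β).natDegree ≤ 1 + (n + 1) + ∑ j ∈ range 7, (KF p n (β j)).natDegree := by
    rw [MF]
    refine (natDegree_mul_le).trans (add_le_add ((natDegree_mul_le).trans (add_le_add hlin hpall)) hprod)
  have h2 : 2 * ∑ j ∈ range 7, β j = ∑ j ∈ range 7, 2 * β j := mul_sum _ _ _
  omega

end ModP

/-! ### Assembly: clearing denominators and reading the valuation -/

section Assembly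

/-- `u_q = e₀(q)^6`, the denominator of the `q`-th pole. -/
def uZ (n q : ℕ) : ℤ := e0Z n q ^ 6

/-- The common denominator `U = ∏_{q ≤ n} u_q`. -/
def Uall (n : ℕ) : ℤ := ∏ q ∈ range (n + 1), uZ n q

/-- The cleared numerator `Z_i = Σ_q z_{q,i} ∏_{s ≠ q} u_s`. -/
def Zsum (n : ℕ) (β : ℕ → ℕ) (i : ℕ) : ℤ :=
  ∑ q ∈ range (n + 1), zZ n β q i * ∏ s ∈ (range (n + 1)).erase q, uZ n s

/-- `U ≠ 0`. -/
theorem Uall_ne_zero (n : ℕ) : Uall n ≠ 0 :=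
  prod_ne_zero_iff.2 fun q _ => pow_ne_zero _ (e0Z_ne_zero n q)

/-- No prime `p > n` divides the common denominator `U`. -/
theorem not_dvd_Uall {p : ℕ} (hp : p.Prime) {n : ℕ} (hn : n < p) : ¬ (p : ℤ) ∣ Uall n := by
  have hpZ : Prime (p : ℤ) := Nat.prime_iff_prime_int.1 hp
  intro h
  obtain ⟨q, hq, hdvd⟩ := (hpZ.dvd_finsetProd_iff _).1 h
  exact not_dvd_e0Z hp hn q (by simpa [Nat.lt_succ_iff] using hq) (hpZ.dvd_of_dvd_pow hdvd)

/-- `U · Σ_q c_{o,q} = Z_{5−o}` for partial-fraction data `c`. -/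
theorem Uall_mul_sum_eq (b : ℕ → ℤ) (hb : InBox b) (hhalf : ∀ j ∈ range 7, 2 * b (j + 1) ≤ b 0 + 1)
    {c : ℕ → ℕ → ℚ} (hc : IsPFData b c) {o : ℕ} (ho : o < 6) :
    (Uall (b 0).toNat : ℚ) * ∑ q ∈ range ((b 0).toNat + 1), c o q =
      (Zsum (b 0).toNat (fun j => (b (j + 1)).toNat) (5 - o) : ℚ) := by
  set n := (b 0).toNat with hn
  rw [mul_sum, Zsum]
  push_cast
  refine sum_congr rfl fun q hq => ?_
  have hq' : q ≤ n := Nat.lt_succ_iff.1 (mem_range.1 hq)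
  rw [Uall, ← mul_prod_erase _ _ hq]
  push_cast
  rw [← pf_coeff_eq b hb hhalf hc hq' ho, uZ]
  push_cast
  ring

/-- `Z_i ≡ −U · Σ_{x ∈ 𝔽_p} [X^{i+1}] M_b(X + x) (mod p)` for `i < 4`. -/
theorem Zsum_cast {p : ℕ} [hp : Fact p.Prime] (hp5 : 5 ≤ p) {n : ℕ} (hn : n < p) (β : ℕ → ℕ)
    {i : ℕ} (hi : i < 4) :
    ((Zsum n β i : ℤ) : ZMod p) =
      -((Uall n : ℤ) : ZMod p) * ∑ x : ZMod p, (taylor x (MF p n β)).coeff (i + 1) := by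
  rw [sum_univ_taylor_MF_coeff hn β (by omega), Zsum, mul_sum]
  push_cast
  refine sum_congr rfl fun q hq => ?_
  have hq' : q ≤ n := Nat.lt_succ_iff.1 (mem_range.1 hq)
  rw [zZ_cast hp5 hn β q hq' hi, Uall, ← mul_prod_erase _ _ hq, uZ]
  push_cast
  ring

/-- The valuation step: `U · w = Z`, `p ∣ Z`, `p ∤ U`, `w ≠ 0` ⟹ `v_p(w) ≥ 1`. -/
theorem one_le_padicValRat_of_eq {p : ℕ} [hp : Fact p.Prime] {U Z : ℤ} {w : ℚ}
    (hUw : (U : ℚ) * w = Z) (hU : ¬ (p : ℤ) ∣ U) (hZ : (p : ℤ) ∣ Z) (hw : w ≠ 0) :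
    1 ≤ padicValRat p w := by
  have hU0 : U ≠ 0 := fun h => hU (h ▸ dvd_zero _)
  have hZ0 : Z ≠ 0 := by
    rintro rfl
    have : (U : ℚ) * w = 0 := by exact_mod_cast hUw
    rcases mul_eq_zero.1 this with h | h
    · exact hU0 (by exact_mod_cast h)
    · exact hw h
  have hw' : w = (Z : ℚ) / (U : ℚ) := by
    rw [eq_div_iff (by exact_mod_cast hU0), mul_comm]; exact hUw
  rw [hw', padicValRat.div (by exact_mod_cast hZ0) (by exact_mod_cast hU0), padicValRat.of_int,
    padicValRat.of_int, padicValInt.eq_zero_of_not_dvd hU, Nat.cast_zero, sub_zero]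
  have := (padicValInt_dvd_iff 1 Z).1 (by simpa using hZ)
  exact_mod_cast this.resolve_left hZ0

/-- Bookkeeping: the natural-number data of an integer parameter vector in the polytope. -/
theorem polytope_data (b : ℕ → ℤ) (hb : InBox b) (h2 : ∀ i ∈ range 7, 2 * b (i + 1) ≤ b 0)
    (h3 : ∑ i ∈ range 7, b (i + 1) ≤ 3 * b 0) :
    (b 0 : ℤ) = ((b 0).toNat : ℤ) ∧
    (∑ i ∈ range 7, b (i + 1)) = ((∑ j ∈ range 7, (b (j + 1)).toNat : ℕ) : ℤ) ∧
    (∀ j ∈ range 7, 2 * (b (j + 1)).toNat ≤ (b 0).toNat) ∧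
    (∑ j ∈ range 7, (b (j + 1)).toNat) ≤ 3 * (b 0).toNat := by
  obtain ⟨h0, hj⟩ := hb
  have e0 : (b 0 : ℤ) = ((b 0).toNat : ℤ) := (Int.toNat_of_nonneg h0).symm
  have ej : ∀ j ∈ range 7, (b (j + 1) : ℤ) = ((b (j + 1)).toNat : ℤ) := fun j hj' =>
    (Int.toNat_of_nonneg (hj j hj').1).symm
  have hS : ∑ i ∈ range 7, b (i + 1) = ((∑ j ∈ range 7, (b (j + 1)).toNat : ℕ) : ℤ) := by
    rw [Nat.cast_sum]; exact sum_congr rfl ej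
  refine ⟨e0, hS, fun j hj' => ?_, ?_⟩
  · have := h2 j hj'; have := ej j hj'; omega
  · have := h3; rw [hS, e0] at this; exact_mod_cast this

open Summit.KontsevichZagierPeriods.Zeta5Search.WedgeDictionary (coeffW coeffU coeffW_eq coeffU_eq
  exists_isPFData dOf)

/-- (W∞) in cleared form: `U · W(b) = Z` with `p ∤ U`, `p ∣ Z` (no non-vanishing hypothesis). -/
theorem exists_clear_coeffW (b : ℕ → ℤ) (p : ℕ) (hb : InBox b)
    (h2 : ∀ i ∈ range 7, 2 * b (i + 1) ≤ b 0) (h3 : ∑ i ∈ range 7, b (i + 1) ≤ 3 * b 0)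
    (hprime : p.Prime) (hp5 : 5 ≤ p) (hpb : b 0 + 1 ≤ (p : ℤ)) (hpd : (p : ℤ) ≤ dOf b + 1) :
    ∃ U Z : ℤ, ¬ (p : ℤ) ∣ U ∧ (p : ℤ) ∣ Z ∧ (U : ℚ) * coeffW b = Z := by
  haveI : Fact p.Prime := ⟨hprime⟩
  obtain ⟨e0, hS, hβ, hS3⟩ := polytope_data b hb h2 h3
  have hnp : (b 0).toNat < p := by omega
  have hpd' : p + ∑ j ∈ range 7, (b (j + 1)).toNat ≤ 3 * (b 0).toNat + 1 := by
    have := hpd; rw [dOf, hS, e0] at this; omega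
  have hhalf : ∀ j ∈ range 7, 2 * b (j + 1) ≤ b 0 + 1 := fun j hj => by have := h2 j hj; omega
  obtain ⟨c, hc⟩ := exists_isPFData b hb (by omega)
  refine ⟨_, _, not_dvd_Uall hprime hnp, ?_,
    by rw [coeffW_eq hc]; exact Uall_mul_sum_eq b hb hhalf hc (by norm_num : 2 < 6)⟩
  rw [← ZMod.intCast_zmod_eq_zero_iff_dvd, Zsum_cast hp5 hnp _ (by norm_num : 3 < 4),
    sum_taylor_coeff_eq_zero (MF p (b 0).toNat fun j => (b (j + 1)).toNat) 4 (by omega), mul_zero]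
  have := natDegree_MF_le (p := p) hnp (fun j => (b (j + 1)).toNat) hβ
  beta_reduce at this
  omega

/-- (U∞) in cleared form: `U · U(b) = Z` with `p ∤ U`, `p ∣ Z`. -/
theorem exists_clear_coeffU (b : ℕ → ℤ) (p : ℕ) (hb : InBox b)
    (h2 : ∀ i ∈ range 7, 2 * b (i + 1) ≤ b 0) (h3 : ∑ i ∈ range 7, b (i + 1) ≤ 3 * b 0)
    (hprime : p.Prime) (hp5 : 5 ≤ p) (hpb : b 0 + 1 ≤ (p : ℤ)) (hpd : 2 * (p : ℤ) ≤ dOf b + 1) :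
    ∃ U Z : ℤ, ¬ (p : ℤ) ∣ U ∧ (p : ℤ) ∣ Z ∧ (U : ℚ) * coeffU b = Z := by
  haveI : Fact p.Prime := ⟨hprime⟩
  obtain ⟨e0, hS, hβ, hS3⟩ := polytope_data b hb h2 h3
  have hnp : (b 0).toNat < p := by omega
  have hpd' : 2 * p + ∑ j ∈ range 7, (b (j + 1)).toNat ≤ 3 * (b 0).toNat + 1 := by
    have := hpd; rw [dOf, hS, e0] at this; omega
  have hhalf : ∀ j ∈ range 7, 2 * b (j + 1) ≤ b 0 + 1 := fun j hj => by have := h2 j hj; omega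
  obtain ⟨c, hc⟩ := exists_isPFData b hb (by omega)
  refine ⟨_, _, not_dvd_Uall hprime hnp, ?_,
    by rw [coeffU_eq hc]; exact Uall_mul_sum_eq b hb hhalf hc (by norm_num : 4 < 6)⟩
  rw [← ZMod.intCast_zmod_eq_zero_iff_dvd, Zsum_cast hp5 hnp _ (by norm_num : 1 < 4),
    sum_taylor_coeff_eq_zero (MF p (b 0).toNat fun j => (b (j + 1)).toNat) 2 (by omega), mul_zero]
  have := natDegree_MF_le (p := p) hnp (fun j => (b (j + 1)).toNat) hβ
  beta_reduce at this
  omega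

/-- **(W∞) THE BIG-PRIME DIVISIBILITY OF THE ζ(3)-COEFFICIENT.**  For `b` in the Brown–Zudilin polytope
(`0 ≤ 2b_j ≤ b₀`, `Σ b_j ≤ 3b₀`) and every prime `p` with `max(5, b₀ + 1) ≤ p ≤ d(b) + 1 = 3b₀ + 1 − Σ_j b_j`
(the Bailey excess), `p` divides the canonical ζ(3)-coefficient `W(b)` of `F̃₇(b)`:  `v_p(W(b)) ≥ 1`. -/
theorem one_le_padicValRat_coeffW (b : ℕ → ℤ) (p : ℕ) (hb : InBox b)
    (h2 : ∀ i ∈ range 7, 2 * b (i + 1) ≤ b 0) (h3 : ∑ i ∈ range 7, b (i + 1) ≤ 3 * b 0)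
    (hprime : p.Prime) (hp5 : 5 ≤ p) (hpb : b 0 + 1 ≤ (p : ℤ)) (hpd : (p : ℤ) ≤ dOf b + 1)
    (hW : coeffW b ≠ 0) : 1 ≤ padicValRat p (coeffW b) := by
  haveI : Fact p.Prime := ⟨hprime⟩
  obtain ⟨U, Z, hU, hZ, hUW⟩ := exists_clear_coeffW b p hb h2 h3 hprime hp5 hpb hpd
  exact one_le_padicValRat_of_eq hUW hU hZ hW

/-- **(U∞) THE BIG-PRIME DIVISIBILITY OF THE ζ(5)-COEFFICIENT.**  For `b` in the polytope and every prime
`p ≥ max(5, b₀ + 1)` with `2p ≤ d(b) + 1`, `p` divides the canonical ζ(5)-coefficient `U(b)`:  `v_p(U(b)) ≥ 1`. -/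
theorem one_le_padicValRat_coeffU (b : ℕ → ℤ) (p : ℕ) (hb : InBox b)
    (h2 : ∀ i ∈ range 7, 2 * b (i + 1) ≤ b 0) (h3 : ∑ i ∈ range 7, b (i + 1) ≤ 3 * b 0)
    (hprime : p.Prime) (hp5 : 5 ≤ p) (hpb : b 0 + 1 ≤ (p : ℤ)) (hpd : 2 * (p : ℤ) ≤ dOf b + 1)
    (hU : coeffU b ≠ 0) : 1 ≤ padicValRat p (coeffU b) := by
  haveI : Fact p.Prime := ⟨hprime⟩
  obtain ⟨U, Z, hU', hZ, hUU⟩ := exists_clear_coeffU b p hb h2 h3 hprime hp5 hpb hpd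
  exact one_le_padicValRat_of_eq hUU hU' hZ hU

end Assembly

end Summit.KontsevichZagierPeriods.Zeta5Search.BigPrime

end
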